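import Summits.ABC.IUTFork.Thm311RealTate
import Summits.ABC.IUTFork.Thm311RealAct
import HarnessLib

/-!
# [IUTchIII] Theorem 3.11 over real definitions, I: the unit embeddings are multiplicative; the LGP splitting monoid is closed under the (b)-action

Record-only file (D-0012) of the abc-iut cell (Cor. 3.12 sub-crew, wave-2 seat abc-iut-c312-5, board row
W2-A); TAKES NO SIDE on [IUTchIII] Cor. 3.12. THEOREMS ONLY. `Thm311RealTate` embeds `K_v` into the
`(j+1)`-tensor packet by `unitEmbed j v : x ↦ 1 ⊗ ⋯ ⊗ 1 ⊗ (x·e_v)` and defines the LGP splitting monoid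
`splittingMonoidLGP X … v qroot ζ ⊆ ∏_j log(^{S^±_{j+1}}D⊢_{v_ℚ})` as the image of abc-iut-L6-t2's
`gaussianSplittingMonoid`; `Thm311RealAct` gives the packets their ring structure ([IUTchIII] Prop. 3.1 (i)) and the
(b)-action `mulAction` by multiplication. Here: `unitEmbed j v (x·y) = unitEmbed j v x · unitEmbed j v y`
(pure tensors multiply componentwise; `e_v` is an idempotent: `Pi.single_mul`), hence `tupleEmbed` is
multiplicative and the LGP splitting monoid — image of a submonoid — is CLOSED UNDER MULTIPLICATION and under the
(b)-action of its own elements ([IUTchIII] Prop. 3.4 (ii) / Thm. 3.11 (i) (b): a monoid "equipped with a(n)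
[multiplicative] action"). (Its unit is the idempotent `1 ⊗ ⋯ ⊗ e_v`, not the `1` of the packet ring — a sub-monoid of
the multiplicative monoid of the ideal `log(^{S^±_{j+1},j}D⊢_v)`, as printed.) [claim: Mochizuki2012, status: disputed]
typed ≠ discharged; instantiated ≠ endorsed.
-/

noncomputable section

open scoped Classical

namespace Summit.ABC.IUTFork.Thm311.Real

open NumberField IsDedekindDomain Literature.IUT.LogVolume Literature.IUT.LogThetaLattice
open Literature.IUT.HodgeArakelov

variable {F : Type} [Field F] [NumberField F] (X : PilotData F) (logv : PadicLogs F)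
  (Aut Ism : ∀ x : Place F, Set (Carrier x ≃ₗ[ℚ] Carrier x))
  (hAut : ∀ x, LinearEquiv.refl ℚ (Carrier x) ∈ Aut x) (hIsm : ∀ x, LinearEquiv.refl ℚ (Carrier x) ∈ Ism x)

/-- The unit family is multiplicative in `x`: at the factor `j`, `(x·y)·e_v = (x·e_v)·(y·e_v)` (`Pi.single_mul`);
at the other factors `1 = 1·1`. [folklore] -/
theorem unitFamily_mul (j : (thetaIndex X).Label) (v : Place F) (x y : Carrier v) :
    unitFamily X logv Aut Ism hAut hIsm j v (x * y) =
      unitFamily X logv Aut Ism hAut hIsm j v x * unitFamily X logv Aut Ism hAut hIsm j v y := by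
  funext i
  show unitFamily X logv Aut Ism hAut hIsm j v (x * y) i =
    unitFamily X logv Aut Ism hAut hIsm j v x i * unitFamily X logv Aut Ism hAut hIsm j v y i
  by_cases hi : i = (thetaIndex X).selfIndex j
  · subst hi
    rw [unitFamily_self, unitFamily_self, unitFamily_self]
    exact Pi.single_mul (α := fun w : (thetaIndex X).Fibre ((thetaIndex X).«over» v) => Carrier w.1)
      ((thetaIndex X).toFibre v) x y
  · unfold unitFamily
    rw [if_neg hi, if_neg hi, if_neg hi]
    funext w
    exact (one_mul (1 : Carrier w.1)).symm

/-- **The unit embedding is multiplicative**: `unitEmbed j v (x·y) = unitEmbed j v x · unitEmbed j v y` in the packet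
ring. [claim: Mochizuki2012, status: disputed] -/
theorem unitEmbed_mul (j : (thetaIndex X).Label) (v : Place F) (x y : Carrier v) :
    unitEmbed X logv Aut Ism hAut hIsm j v (x * y) =
      unitEmbed X logv Aut Ism hAut hIsm j v x * unitEmbed X logv Aut Ism hAut hIsm j v y := by
  unfold unitEmbed
  rw [unitFamily_mul, tprod_mul_tprod]

/-- `tupleEmbed` is multiplicative (componentwise in `j`). [folklore] -/
theorem tupleEmbed_mul (v : Place F) (x y : (thetaIndex X).LabelStar → Carrier v) :
    tupleEmbed X logv Aut Ism hAut hIsm v (x * y) =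
      tupleEmbed X logv Aut Ism hAut hIsm v x * tupleEmbed X logv Aut Ism hAut hIsm v y := by
  funext j
  exact unitEmbed_mul X logv Aut Ism hAut hIsm j.1 v (x j) (y j)

/-- **The LGP splitting monoid is closed under multiplication** (image of abc-iut-L6-t2's submonoid
`gaussianSplittingMonoid` under the multiplicative `tupleEmbed`). [claim: Mochizuki2012, status: disputed] -/
theorem mul_mem_splittingMonoidLGP (v : HeightOneSpectrum (𝓞 F)) (qroot : Carrier (.inr v : Place F))
    (ζ : (thetaIndex X).LabelStar → (Carrier (.inr v : Place F))ˣ)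
    {s t : (logShells X logv Aut Ism hAut hIsm).StarPacket (.inr v : Place F)}
    (hs : s ∈ splittingMonoidLGP X logv Aut Ism hAut hIsm v qroot ζ)
    (ht : t ∈ splittingMonoidLGP X logv Aut Ism hAut hIsm v qroot ζ) :
    s * t ∈ splittingMonoidLGP X logv Aut Ism hAut hIsm v qroot ζ := by
  obtain ⟨a, ha, rfl⟩ := hs
  obtain ⟨b, hb, rfl⟩ := ht
  exact ⟨a * b, Submonoid.mul_mem _ ha hb, tupleEmbed_mul X logv Aut Ism hAut hIsm _ a b⟩

/-- The (b)-action of `s` on `t` is the product `s·t` in `∏_j log(^{S^±_{j+1}}D⊢_{v_ℚ})`. [folklore] -/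
theorem mulAction_eq_mul (v : Place F) (s t : (logShells X logv Aut Ism hAut hIsm).StarPacket v) :
    mulAction X logv Aut Ism hAut hIsm v s t = s * t := rfl

/-- **The LGP splitting monoid is closed under the (b)-action of its elements** ([IUTchIII] Prop. 3.4 (ii) / Thm.
3.11 (i) (b): a monoid with its multiplicative action). [claim: Mochizuki2012, status: disputed] -/
theorem mulAction_mem_splittingMonoidLGP (v : HeightOneSpectrum (𝓞 F)) (qroot : Carrier (.inr v : Place F))
    (ζ : (thetaIndex X).LabelStar → (Carrier (.inr v : Place F))ˣ)
    {s t : (logShells X logv Aut Ism hAut hIsm).StarPacket (.inr v : Place F)}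
    (hs : s ∈ splittingMonoidLGP X logv Aut Ism hAut hIsm v qroot ζ)
    (ht : t ∈ splittingMonoidLGP X logv Aut Ism hAut hIsm v qroot ζ) :
    mulAction X logv Aut Ism hAut hIsm (.inr v) s t ∈ splittingMonoidLGP X logv Aut Ism hAut hIsm v qroot ζ :=
  mul_mem_splittingMonoidLGP X logv Aut Ism hAut hIsm v qroot ζ hs ht

end Summit.ABC.IUTFork.Thm311.Real

end
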